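import Summits.AtomisticToContinuum.Crystallization.Theorems.FrustratedLawDichotomyNoTwistOfPairBound

/-!
# FrustratedLawDichotomy · crux `AperiodicFrustratedLawGap` (stmt-AtomisticToContinuum-27623) — THE CENTRE-AWARE THREE-POINT LENS LEMMA and
# the abstract THIRD-NEIGHBOUR EXCLUSION behind P's `√3`-bound (decomp-a2c, prover hand 2, gen 11)

P's thinnest certificate (critic rows 465/472) is the `√3`-pair bound `LinkPairBound θ D₀ √3 Pat`: it is used ONLY to feed the three-point
lens lemma `lens_three_false` (p823554) inside `noTwist_of_pairBound` (p823632) — two first-shell sites `τ a, τ c` at distance `≥ D₀·nn_i`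
cannot have a third common neighbour `X` besides the centre `i` and the corner `τ w`.  That lemma treats the three common neighbours
uniformly (windows `[(1+θ)⁻², (1+θ)⁴]`, separations `(1+θ)⁻¹`), which at `θ = 1/100` needs `D₀ ≥ 1.693` against a float minimum `1.7146`
(census TAG 160 (d′)) — a `2θ` window.  But the centre is special: its distances to `τ a, τ c` are `‖q (τ a)‖, ‖q (τ c)‖ ∈ [1, 1+θ]`
(squared window `[1, (1+θ)²]`, a smaller lens circle), and both other neighbours are `≥ 1` (not `(1+θ)⁻¹`) away from it.  With the angle
chain «`cos α, cos β ≤ −κ ≤ 0 ⟹ cos (α − β) ≥ 2κ² − 1`» in place of «two of three directions within `2π/3`» this gives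

* ★ `lens_three_false_centre` — `A, B` at distance `≥ D₀`; `P₀` with squared window `[lo₀, hi₀]`, `P₁, P₂` with `[lo, hi]`; separations
  `dist P₀ Pⱼ ≥ s₀`, `dist P₁ P₂ ≥ s`; three polynomial conditions (A) `R₀² + R² < S₀`, (C) `2R² < S`, (B) `4R²R₀² − (S₀ − R₀² − R²)² < S·R₀²`
  (`R₀² = hi₀ − D₀²/4`, `R² = hi − D₀²/4`, `S₀ = s₀² − (δ₀ + δ)²`, `S = s² − 4δ²`, `δ₀ = (hi₀ − lo₀)/(2D₀)`, `δ = (hi − lo)/(2D₀)`) ⟹ `False`.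
  At `θ = 1/100` the threshold drops from `1.693` to `1.677` (exact check: holds at `D₀ = 42/25`, fails at `167/100`); a local five-point
  feasibility probe shows the local problem `{0, τ w, X, τ a, τ c}` itself becomes feasible near `1.66`, so this is close to optimal for any
  argument using these five points only.
* `ThirdNeighbourExclusion θ D₀` — the ABSTRACT statement the corner lemma consumes (rescaled cluster, unit `nn_i`, centre `0`): first-shell
  `A, B` at distance `≥ D₀` admit no pair `P₁` (first shell), `P₂` (`‖P₂‖ ≥ 1`) inside the coupled windows and `(1+θ)⁻¹` apart.  Any future
  sharpening of the lens plugs in here; the combinatorial files (`…ThirdNeighbourNoTwist`, `…ScalarBoundsPSharp`) never change again.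
* instances: `thirdNeighbourExclusion_of_lensThree` (the crude condition of p823632, e.g. `D₀ = 17/10`, `339/200` at `θ = 1/100`),
  `thirdNeighbourExclusion_of_centre` (the sharp one: `D₀ = 42/25` at `1/100`, `83/50` at `1/200`), monotonicity in `D₀`.
`[folklore]` elementary geometry; one definition; no `sorry`; no `instance`/`notation`.
-/

noncomputable section

namespace Summit.AtomisticToContinuum.Crystallization.Theorems.FrustratedLawDichotomyThirdNeighbour

open Real RealInnerProductSpace
open Summit.AtomisticToContinuum.Crystallization.Theorems.FrustratedLawDichotomyTwoShellRigidityCut (E3)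
open Summit.AtomisticToContinuum.Crystallization.Theorems.FrustratedLawDichotomyLensFive
  (planar_dist_sq exists_frame dist_sq_decomp dist_sq_eq_sum_sq)
open Summit.AtomisticToContinuum.Crystallization.Theorems.FrustratedLawDichotomyLensThree (lens_three_false)

/-! ### §1 Planar pieces -/

/-- **Angle chain**: if `cos α ≤ −κ` and `cos β ≤ −κ` with `κ ≥ 0`, then `cos (α − β) ≥ 2κ² − 1` (both directions lie in the arc of
half-width `arccos (−κ) ≥ π/2` opposite the reference direction, so they are within `2·(π − arccos(−κ))` of each other). [folklore] -/
theorem cos_sub_ge_of_cos_le_neg {α β κ : ℝ} (hκ : 0 ≤ κ) (hα : cos α ≤ -κ) (hβ : cos β ≤ -κ) :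
    2 * κ ^ 2 - 1 ≤ cos (α - β) := by
  rw [cos_sub]
  have hκ1 : κ ≤ 1 := by linarith [neg_one_le_cos α]
  have hα' : κ ≤ -cos α := by linarith
  have hβ' : κ ≤ -cos β := by linarith
  have h1 : κ ^ 2 ≤ cos α * cos β := by
    have := mul_le_mul hα' hβ' hκ (hκ.trans hα')
    nlinarith
  have hsa : sin α ^ 2 ≤ 1 - κ ^ 2 := by rw [sin_sq]; nlinarith
  have hsb : sin β ^ 2 ≤ 1 - κ ^ 2 := by rw [sin_sq]; nlinarith
  have h2 : |sin α * sin β| ≤ 1 - κ ^ 2 := by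
    refine abs_le_of_sq_le_sq ?_ (by nlinarith)
    rw [mul_pow]
    calc sin α ^ 2 * sin β ^ 2 ≤ (1 - κ ^ 2) * (1 - κ ^ 2) :=
          mul_le_mul hsa hsb (sq_nonneg _) (by nlinarith)
      _ = (1 - κ ^ 2) ^ 2 := by ring
  have h3 : -(1 - κ ^ 2) ≤ sin α * sin β := (abs_le.1 h2).1
  linarith

/-- **Axial and planar bounds for a common neighbour**: in an orthonormal frame `b` with `B − A = d • b 2`, `d ≥ D₀ > 0`, a point `P` with
`lo' ≤ dist² ≤ hi'` to both `A` and `B` has axial coordinate `|H| ≤ (hi' − lo')/(2D₀)` and planar radius² `≤ hi' − D₀²/4` (coordinates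
relative to the midpoint). [folklore] -/
theorem axial_planar_bounds (b : OrthonormalBasis (Fin 3) ℝ E3) {A B : E3} {d D₀ lo' hi' : ℝ} (hBA : B - A = d • b 2)
    (hD₀ : 0 < D₀) (hd : D₀ ≤ d) (P : E3)
    (hA : lo' ≤ dist P A ^ 2 ∧ dist P A ^ 2 ≤ hi') (hB : lo' ≤ dist P B ^ 2 ∧ dist P B ^ 2 ≤ hi') :
    |⟪b 2, P - (1 / 2 : ℝ) • (A + B)⟫| ≤ (hi' - lo') / (2 * D₀) ∧
      ⟪b 0, P - (1 / 2 : ℝ) • (A + B)⟫ ^ 2 + ⟪b 1, P - (1 / 2 : ℝ) • (A + B)⟫ ^ 2 ≤ hi' - D₀ ^ 2 / 4 := by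
  obtain ⟨h1, h2⟩ := dist_sq_decomp b hBA P
  set X : ℝ := ⟪b 0, P - (1 / 2 : ℝ) • (A + B)⟫
  set Y : ℝ := ⟪b 1, P - (1 / 2 : ℝ) • (A + B)⟫
  set H : ℝ := ⟪b 2, P - (1 / 2 : ℝ) • (A + B)⟫
  have hdpos : 0 < d := hD₀.trans_le hd
  constructor
  · have hdH : |d * H| ≤ (hi' - lo') / 2 := by
      rw [abs_le]; constructor <;> nlinarith [hA.1, hA.2, hB.1, hB.2]
    rw [abs_mul, abs_of_pos hdpos] at hdH
    rw [le_div_iff₀ (by positivity)]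
    calc |H| * (2 * D₀) ≤ |H| * (2 * d) := by gcongr
      _ = 2 * (d * |H|) := by ring
      _ ≤ 2 * ((hi' - lo') / 2) := by gcongr
      _ = hi' - lo' := by ring
  · have hdd : D₀ ^ 2 ≤ d ^ 2 := pow_le_pow_left₀ hD₀.le hd 2
    nlinarith [hA.2, hB.2, sq_nonneg H]

/-- **Planar separation** of two points from their spatial separation and their axial bounds. [folklore] -/
theorem planar_sep_of_dist (b : OrthonormalBasis (Fin 3) ℝ E3) (M P P' : E3) {t δ δ' : ℝ} (ht : 0 ≤ t) (hPP' : t ≤ dist P P')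
    (hH : |⟪b 2, P - M⟫| ≤ δ) (hH' : |⟪b 2, P' - M⟫| ≤ δ') :
    t ^ 2 - (δ + δ') ^ 2 ≤ (⟪b 0, P - M⟫ - ⟪b 0, P' - M⟫) ^ 2 + (⟪b 1, P - M⟫ - ⟪b 1, P' - M⟫) ^ 2 := by
  have h1 := dist_sq_eq_sum_sq b M P P'
  have h2 : t ^ 2 ≤ dist P P' ^ 2 := pow_le_pow_left₀ ht hPP' 2
  rw [abs_le] at hH hH'
  have h3 : (⟪b 2, P - M⟫ - ⟪b 2, P' - M⟫) ^ 2 ≤ (δ + δ') ^ 2 :=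
    sq_le_sq' (by linarith [hH.1, hH'.2]) (by linarith [hH.2, hH'.1])
  linarith

/-- **Polar law-of-cosines bound**: `S ≤ ρ² + ρ'² − 2ρρ'c` with `0 ≤ ρ ≤ R`, `0 ≤ ρ' ≤ R'` and `R² + R'² < S` forces `c < 0` and
`S − R² − R'² ≤ 2RR'·(−c)`. [folklore] -/
theorem neg_cos_bound {ρ ρ' R R' c S : ℝ} (hρ0 : 0 ≤ ρ) (hρ : ρ ≤ R) (hρ'0 : 0 ≤ ρ') (hρ' : ρ' ≤ R')
    (hS : S ≤ ρ ^ 2 + ρ' ^ 2 - 2 * (ρ * ρ') * c) (hnum : R ^ 2 + R' ^ 2 < S) :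
    c < 0 ∧ S - R ^ 2 - R' ^ 2 ≤ 2 * (R * R') * (-c) := by
  have hR : ρ ^ 2 ≤ R ^ 2 := pow_le_pow_left₀ hρ0 hρ 2
  have hR' : ρ' ^ 2 ≤ R' ^ 2 := pow_le_pow_left₀ hρ'0 hρ' 2
  have hc : c < 0 := by
    by_contra h
    push Not at h
    have : 0 ≤ 2 * (ρ * ρ') * c := by positivity
    linarith
  refine ⟨hc, ?_⟩
  have h1 : ρ * ρ' ≤ R * R' := mul_le_mul hρ hρ' hρ'0 (hρ0.trans hρ)
  have h2 : 2 * (ρ * ρ') * (-c) ≤ 2 * (R * R') * (-c) := by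
    have hc' : 0 ≤ -c := by linarith
    nlinarith
  linarith

/-! ### §2 The centre-aware three-point lens lemma -/

/-- ★ **THE CENTRE-AWARE THREE-POINT LENS LEMMA.**  `A, B` at distance `≥ D₀ > 0`; a common neighbour `P₀` with squared window
`[lo₀, hi₀]`, two common neighbours `P₁, P₂` with squared window `[lo, hi]`; `dist P₀ Pⱼ ≥ s₀`, `dist P₁ P₂ ≥ s`; and, writing
`R₀² = hi₀ − D₀²/4`, `R² = hi − D₀²/4`, `δ₀ = (hi₀ − lo₀)/(2D₀)`, `δ = (hi − lo)/(2D₀)`, `S₀ = s₀² − (δ₀ + δ)²`, `S = s² − (2δ)²`: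
(A) `R₀² + R² < S₀`, (C) `2R² < S`, (B) `4R²R₀² − (S₀ − R₀² − R²)² < S·R₀²`, with `R₀², R² > 0`.  Then `False`. [folklore] -/
theorem lens_three_false_centre {A B P₀ P₁ P₂ : E3} {D₀ lo₀ hi₀ lo hi s₀ s : ℝ}
    (hD₀ : 0 < D₀) (hd : D₀ ≤ dist A B)
    (hA₀ : lo₀ ≤ dist P₀ A ^ 2 ∧ dist P₀ A ^ 2 ≤ hi₀) (hB₀ : lo₀ ≤ dist P₀ B ^ 2 ∧ dist P₀ B ^ 2 ≤ hi₀)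
    (hA₁ : lo ≤ dist P₁ A ^ 2 ∧ dist P₁ A ^ 2 ≤ hi) (hB₁ : lo ≤ dist P₁ B ^ 2 ∧ dist P₁ B ^ 2 ≤ hi)
    (hA₂ : lo ≤ dist P₂ A ^ 2 ∧ dist P₂ A ^ 2 ≤ hi) (hB₂ : lo ≤ dist P₂ B ^ 2 ∧ dist P₂ B ^ 2 ≤ hi)
    (hs₀ : 0 ≤ s₀) (hs : 0 ≤ s) (h01 : s₀ ≤ dist P₀ P₁) (h02 : s₀ ≤ dist P₀ P₂) (h12 : s ≤ dist P₁ P₂)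
    (hR₀ : 0 < hi₀ - D₀ ^ 2 / 4) (hR : 0 < hi - D₀ ^ 2 / 4)
    (hnumA : (hi₀ - D₀ ^ 2 / 4) + (hi - D₀ ^ 2 / 4) <
      s₀ ^ 2 - ((hi₀ - lo₀) / (2 * D₀) + (hi - lo) / (2 * D₀)) ^ 2)
    (hnumC : 2 * (hi - D₀ ^ 2 / 4) < s ^ 2 - ((hi - lo) / (2 * D₀) + (hi - lo) / (2 * D₀)) ^ 2)
    (hnumB : 4 * (hi - D₀ ^ 2 / 4) * (hi₀ - D₀ ^ 2 / 4) -
        (s₀ ^ 2 - ((hi₀ - lo₀) / (2 * D₀) + (hi - lo) / (2 * D₀)) ^ 2 - (hi₀ - D₀ ^ 2 / 4) - (hi - D₀ ^ 2 / 4)) ^ 2 <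
      (s ^ 2 - ((hi - lo) / (2 * D₀) + (hi - lo) / (2 * D₀)) ^ 2) * (hi₀ - D₀ ^ 2 / 4)) : False := by
  set d := dist A B with hd_def
  have hdpos : 0 < d := hD₀.trans_le hd
  have hAB : A ≠ B := fun h => by rw [hd_def, h, dist_self] at hdpos; exact lt_irrefl _ hdpos
  obtain ⟨b, hBA⟩ := exists_frame hAB
  rw [← hd_def] at hBA
  set M : E3 := (1 / 2 : ℝ) • (A + B) with hM
  -- names for the abstract quantities
  set R02 : ℝ := hi₀ - D₀ ^ 2 / 4 with hR02
  set R2 : ℝ := hi - D₀ ^ 2 / 4 with hR2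
  set δ₀ : ℝ := (hi₀ - lo₀) / (2 * D₀) with hδ₀
  set δ : ℝ := (hi - lo) / (2 * D₀) with hδ
  set S₀ : ℝ := s₀ ^ 2 - (δ₀ + δ) ^ 2 with hS₀
  set S : ℝ := s ^ 2 - (δ + δ) ^ 2 with hS
  set T : ℝ := S₀ - R02 - R2 with hT
  -- coordinates (the point list `![P₀, P₁, P₂]`; types are fixed by ascription, bodies agree definitionally)
  set X : Fin 3 → ℝ := fun k => ⟪b 0, (![P₀, P₁, P₂] k) - M⟫ with hXdef
  set Y : Fin 3 → ℝ := fun k => ⟪b 1, (![P₀, P₁, P₂] k) - M⟫ with hYdef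
  have hb0 : |⟪b 2, P₀ - M⟫| ≤ δ₀ ∧ X 0 ^ 2 + Y 0 ^ 2 ≤ R02 := axial_planar_bounds b hBA hD₀ hd P₀ hA₀ hB₀
  have hb1 : |⟪b 2, P₁ - M⟫| ≤ δ ∧ X 1 ^ 2 + Y 1 ^ 2 ≤ R2 := axial_planar_bounds b hBA hD₀ hd P₁ hA₁ hB₁
  have hb2 : |⟪b 2, P₂ - M⟫| ≤ δ ∧ X 2 ^ 2 + Y 2 ^ 2 ≤ R2 := axial_planar_bounds b hBA hD₀ hd P₂ hA₂ hB₂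
  have hρ2_0 : X 0 ^ 2 + Y 0 ^ 2 ≤ R02 := hb0.2
  have hρ2_1 : X 1 ^ 2 + Y 1 ^ 2 ≤ R2 := hb1.2
  have hρ2_2 : X 2 ^ 2 + Y 2 ^ 2 ≤ R2 := hb2.2
  -- planar separations
  have hp01 : S₀ ≤ (X 0 - X 1) ^ 2 + (Y 0 - Y 1) ^ 2 := planar_sep_of_dist b M P₀ P₁ hs₀ h01 hb0.1 hb1.1
  have hp02 : S₀ ≤ (X 0 - X 2) ^ 2 + (Y 0 - Y 2) ^ 2 := planar_sep_of_dist b M P₀ P₂ hs₀ h02 hb0.1 hb2.1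
  have hp12 : S ≤ (X 1 - X 2) ^ 2 + (Y 1 - Y 2) ^ 2 := planar_sep_of_dist b M P₁ P₂ hs h12 hb1.1 hb2.1
  -- polar coordinates
  set θ : Fin 3 → ℝ := fun k => Complex.arg ⟨X k, Y k⟩ with hθdef
  set ρ : Fin 3 → ℝ := fun k => ‖(⟨X k, Y k⟩ : ℂ)‖ with hρdef
  have hρnn : ∀ k, 0 ≤ ρ k := fun k => norm_nonneg _
  have hρsq : ∀ k, ρ k ^ 2 = X k ^ 2 + Y k ^ 2 := by
    intro k
    simp only [hρdef]
    rw [Complex.norm_def, Real.sq_sqrt (Complex.normSq_nonneg _), Complex.normSq_mk]; ring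
  have hpl : ∀ i j, (X i - X j) ^ 2 + (Y i - Y j) ^ 2 = ρ i ^ 2 + ρ j ^ 2 - 2 * (ρ i * ρ j) * cos (θ i - θ j) :=
    fun i j => planar_dist_sq (X i) (Y i) (X j) (Y j)
  -- radii
  set R₀' : ℝ := Real.sqrt R02 with hR₀'
  set R' : ℝ := Real.sqrt R2 with hR'
  have hR₀'sq : R₀' ^ 2 = R02 := Real.sq_sqrt hR₀.le
  have hR'sq : R' ^ 2 = R2 := Real.sq_sqrt hR.le
  have hR₀'pos : 0 < R₀' := Real.sqrt_pos.2 hR₀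
  have hR'pos : 0 < R' := Real.sqrt_pos.2 hR
  have hρR0 : ρ 0 ≤ R₀' := by
    rw [hR₀', ← Real.sqrt_sq (hρnn 0)]
    exact Real.sqrt_le_sqrt (by rw [hρsq]; exact hρ2_0)
  have hρR1 : ρ 1 ≤ R' := by
    rw [hR', ← Real.sqrt_sq (hρnn 1)]
    exact Real.sqrt_le_sqrt (by rw [hρsq]; exact hρ2_1)
  have hρR2 : ρ 2 ≤ R' := by
    rw [hR', ← Real.sqrt_sq (hρnn 2)]
    exact Real.sqrt_le_sqrt (by rw [hρsq]; exact hρ2_2)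
  -- the two gaps at the centre's neighbour P₀
  have hnumA' : R₀' ^ 2 + R' ^ 2 < S₀ := by rw [hR₀'sq, hR'sq]; exact hnumA
  have hS01 : S₀ ≤ ρ 0 ^ 2 + ρ 1 ^ 2 - 2 * (ρ 0 * ρ 1) * cos (θ 0 - θ 1) := by rw [← hpl]; exact hp01
  have hS02 : S₀ ≤ ρ 0 ^ 2 + ρ 2 ^ 2 - 2 * (ρ 0 * ρ 2) * cos (θ 0 - θ 2) := by rw [← hpl]; exact hp02
  obtain ⟨hc1, hT1⟩ := neg_cos_bound (hρnn 0) hρR0 (hρnn 1) hρR1 hS01 hnumA'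
  obtain ⟨hc2, hT2⟩ := neg_cos_bound (hρnn 0) hρR0 (hρnn 2) hρR2 hS02 hnumA'
  have hTpos : 0 < T := by rw [hT]; linarith
  set W : ℝ := 2 * (R₀' * R') with hW
  have hWpos : 0 < W := by rw [hW]; positivity
  set κ : ℝ := T / W with hκ
  have hκpos : 0 < κ := div_pos hTpos hWpos
  have hκW : κ * W = T := by rw [hκ]; exact div_mul_cancel₀ T hWpos.ne'
  have hT1' : T ≤ W * (-cos (θ 0 - θ 1)) := by rw [hT, hW, ← hR₀'sq, ← hR'sq]; linarith
  have hT2' : T ≤ W * (-cos (θ 0 - θ 2)) := by rw [hT, hW, ← hR₀'sq, ← hR'sq]; linarith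
  have hκ1 : cos (θ 0 - θ 1) ≤ -κ := by
    by_contra hlt
    push Not at hlt
    have : W * (-cos (θ 0 - θ 1)) < W * κ := mul_lt_mul_of_pos_left (by linarith) hWpos
    linarith
  have hκ2 : cos (θ 0 - θ 2) ≤ -κ := by
    by_contra hlt
    push Not at hlt
    have : W * (-cos (θ 0 - θ 2)) < W * κ := mul_lt_mul_of_pos_left (by linarith) hWpos
    linarith
  -- the third gap
  have hchain : 2 * κ ^ 2 - 1 ≤ cos (θ 1 - θ 2) := by
    have h := cos_sub_ge_of_cos_le_neg hκpos.le hκ1 hκ2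
    have e : θ 0 - θ 1 - (θ 0 - θ 2) = -(θ 1 - θ 2) := by ring
    rwa [e, cos_neg] at h
  have hS12 : S ≤ ρ 1 ^ 2 + ρ 2 ^ 2 - 2 * (ρ 1 * ρ 2) * cos (θ 1 - θ 2) := by rw [← hpl]; exact hp12
  have hρ1sq : ρ 1 ^ 2 ≤ R' ^ 2 := pow_le_pow_left₀ (hρnn 1) hρR1 2
  have hρ2sq : ρ 2 ^ 2 ≤ R' ^ 2 := pow_le_pow_left₀ (hρnn 2) hρR2 2
  have hnumC' : 2 * R' ^ 2 < S := by rw [hR'sq]; exact hnumC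
  by_cases hc12 : 0 ≤ cos (θ 1 - θ 2)
  · have : 0 ≤ 2 * (ρ 1 * ρ 2) * cos (θ 1 - θ 2) := by
      have := hρnn 1; have := hρnn 2; positivity
    linarith
  · push Not at hc12
    have h12' : ρ 1 * ρ 2 ≤ R' * R' := mul_le_mul hρR1 hρR2 (hρnn 2) hR'pos.le
    have hS' : S ≤ 2 * R' ^ 2 + 2 * (R' * R') * (1 - 2 * κ ^ 2) := by
      have h1 : 2 * (ρ 1 * ρ 2) * (-cos (θ 1 - θ 2)) ≤ 2 * (R' * R') * (-cos (θ 1 - θ 2)) :=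
        mul_le_mul_of_nonneg_right (by linarith [h12']) (by linarith)
      have h2 : 2 * (R' * R') * (-cos (θ 1 - θ 2)) ≤ 2 * (R' * R') * (1 - 2 * κ ^ 2) :=
        mul_le_mul_of_nonneg_left (by linarith [hchain]) (by positivity)
      have h3 : ρ 1 ^ 2 + ρ 2 ^ 2 - 2 * (ρ 1 * ρ 2) * cos (θ 1 - θ 2) =
          ρ 1 ^ 2 + ρ 2 ^ 2 + 2 * (ρ 1 * ρ 2) * (-cos (θ 1 - θ 2)) := by ring
      have h4 : 2 * R' ^ 2 + 2 * (R' * R') * (1 - 2 * κ ^ 2) =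
          R' ^ 2 + R' ^ 2 + 2 * (R' * R') * (1 - 2 * κ ^ 2) := by ring
      rw [h4]
      rw [h3] at hS12
      linarith [hS12, h1, h2, hρ1sq, hρ2sq]
    -- `S ≤ 4 R² − 4 R² κ²` and `4 R² κ² R₀² = T²`
    have hW2 : W ^ 2 = 4 * (R02 * R2) := by rw [hW, mul_pow, mul_pow, hR₀'sq, hR'sq]; ring
    have hkey : 4 * R2 * κ ^ 2 * R02 = T ^ 2 := by
      have h : (κ * W) ^ 2 = T ^ 2 := by rw [hκW]
      rw [mul_pow, hW2] at h
      linear_combination h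
    have e1 : R' * R' = R2 := by rw [← hR'sq]; ring
    rw [e1, hR'sq] at hS'
    have hS2 : S * R02 ≤ (2 * R2 + 2 * R2 * (1 - 2 * κ ^ 2)) * R02 := mul_le_mul_of_nonneg_right hS' hR₀.le
    have e2 : (2 * R2 + 2 * R2 * (1 - 2 * κ ^ 2)) * R02 = 4 * R2 * R02 - T ^ 2 := by
      linear_combination (-1 : ℝ) * hkey
    rw [e2] at hS2
    linarith [hS2, hnumB]

/-! ### §3 The abstract third-neighbour exclusion and its instances -/

/-- **`ThirdNeighbourExclusion θ D₀`** — in a cluster rescaled to unit nearest-neighbour distance at the centre `0`: two first-shell points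
`A, B` (`1 ≤ ‖·‖ ≤ 1+θ`) at distance `≥ D₀` have no pair of further common neighbours `P₁` (first shell) and `P₂` (`‖P₂‖ ≥ 1`) inside the
coupled windows `[(1+θ)⁻², (1+θ)⁴]` (squared) that are `(1+θ)⁻¹` apart.  This is exactly what `noTwist_of_pairBound` (p823632) needs from
the `√3`-bound; any lens lemma discharges it. [certificate interface; five points] -/
def ThirdNeighbourExclusion (θ D₀ : ℝ) : Prop :=
  ∀ A B P₁ P₂ : E3, D₀ ≤ dist A B →
    1 ≤ ‖A‖ → ‖A‖ ≤ 1 + θ → 1 ≤ ‖B‖ → ‖B‖ ≤ 1 + θ →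
    ((1 + θ)⁻¹ ^ 2 ≤ dist P₁ A ^ 2 ∧ dist P₁ A ^ 2 ≤ ((1 + θ) ^ 2) ^ 2) →
    ((1 + θ)⁻¹ ^ 2 ≤ dist P₁ B ^ 2 ∧ dist P₁ B ^ 2 ≤ ((1 + θ) ^ 2) ^ 2) →
    ((1 + θ)⁻¹ ^ 2 ≤ dist P₂ A ^ 2 ∧ dist P₂ A ^ 2 ≤ ((1 + θ) ^ 2) ^ 2) →
    ((1 + θ)⁻¹ ^ 2 ≤ dist P₂ B ^ 2 ∧ dist P₂ B ^ 2 ≤ ((1 + θ) ^ 2) ^ 2) →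
    1 ≤ ‖P₁‖ → ‖P₁‖ ≤ 1 + θ → 1 ≤ ‖P₂‖ → (1 + θ)⁻¹ ≤ dist P₁ P₂ → False

/-- Monotonicity in `D₀`: a larger distance threshold is a weaker demand. [folklore] -/
theorem ThirdNeighbourExclusion.mono {θ D₀ D₀' : ℝ} (h : ThirdNeighbourExclusion θ D₀) (hle : D₀ ≤ D₀') :
    ThirdNeighbourExclusion θ D₀' :=
  fun A B P₁ P₂ hd => h A B P₁ P₂ (hle.trans hd)

/-- **The crude instance**: the uniform-window lens condition of `noTwist_of_pairBound` (p823632) gives the exclusion. [folklore] -/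
theorem thirdNeighbourExclusion_of_lensThree {θ D₀ : ℝ} (hθ : 0 ≤ θ) (hD₀ : 0 < D₀)
    (hnum : 3 * (((1 + θ) ^ 2) ^ 2 - D₀ ^ 2 / 4) < (1 + θ)⁻¹ ^ 2 - ((((1 + θ) ^ 2) ^ 2 - (1 + θ)⁻¹ ^ 2) / D₀) ^ 2) :
    ThirdNeighbourExclusion θ D₀ := by
  intro A B P₁ P₂ hd hA1 hA2 hB1 hB2 hwA1 hwB1 hwA2 hwB2 hP1 _hP1' hP2 h12
  have hθpos : 0 < 1 + θ := by linarith
  set lam : ℝ := 1 + θ with hlam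
  have hlam1 : 1 ≤ lam := by rw [hlam]; linarith
  have hinv1 : lam⁻¹ ≤ 1 := inv_le_one_of_one_le₀ hlam1
  have win0 : ∀ Z : E3, 1 ≤ ‖Z‖ → ‖Z‖ ≤ lam →
      lam⁻¹ ^ 2 ≤ dist (0 : E3) Z ^ 2 ∧ dist (0 : E3) Z ^ 2 ≤ (lam ^ 2) ^ 2 := by
    intro Z h1 h2
    rw [dist_comm, dist_eq_norm, sub_zero]
    have h3 : ‖Z‖ ≤ lam ^ 2 := h2.trans (by clear hnum hd hwA1 hwB1 hwA2 hwB2 h12 h1 h2; nlinarith)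
    exact ⟨pow_le_pow_left₀ (inv_nonneg.2 hθpos.le) (hinv1.trans h1) 2, pow_le_pow_left₀ (norm_nonneg _) h3 2⟩
  let P : Fin 3 → E3 := ![0, P₁, P₂]
  refine lens_three_false (A := A) (B := B) (P := P) (D₀ := D₀) (lo := lam⁻¹ ^ 2) (hi := (lam ^ 2) ^ 2)
    (s := lam⁻¹) hD₀ hd ?_ ?_ (inv_nonneg.2 hθpos.le) ?_ hnum
  · intro k
    fin_cases k
    · simpa [P] using win0 A hA1 hA2
    · simpa [P] using hwA1
    · simpa [P] using hwA2
  · intro k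
    fin_cases k
    · simpa [P] using win0 B hB1 hB2
    · simpa [P] using hwB1
    · simpa [P] using hwB2
  · have d01 : lam⁻¹ ≤ dist (0 : E3) P₁ := by
      rw [dist_comm, dist_eq_norm, sub_zero]; exact hinv1.trans hP1
    have d02 : lam⁻¹ ≤ dist (0 : E3) P₂ := by
      rw [dist_comm, dist_eq_norm, sub_zero]; exact hinv1.trans hP2
    intro j k hjk
    fin_cases j <;> fin_cases k <;> simp at hjk
    · simpa [P] using d01
    · simpa [P] using d02
    · simpa [P, dist_comm] using d01
    · simpa [P] using h12
    · simpa [P, dist_comm] using d02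
    · simpa [P, dist_comm] using h12

/-- ★ **The sharp instance**: the centre-aware conditions (A), (B), (C) at `lo₀ = 1`, `hi₀ = (1+θ)²`, `lo = (1+θ)⁻²`, `hi = (1+θ)⁴`,
`s₀ = 1`, `s = (1+θ)⁻¹` give the exclusion. [folklore] -/
theorem thirdNeighbourExclusion_of_centre {θ D₀ : ℝ} (hθ : 0 ≤ θ) (hD₀ : 0 < D₀)
    (hR₀ : 0 < (1 + θ) ^ 2 - D₀ ^ 2 / 4)
    (hnumA : ((1 + θ) ^ 2 - D₀ ^ 2 / 4) + (((1 + θ) ^ 2) ^ 2 - D₀ ^ 2 / 4) <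
      (1 : ℝ) ^ 2 - (((1 + θ) ^ 2 - 1) / (2 * D₀) + (((1 + θ) ^ 2) ^ 2 - (1 + θ)⁻¹ ^ 2) / (2 * D₀)) ^ 2)
    (hnumC : 2 * (((1 + θ) ^ 2) ^ 2 - D₀ ^ 2 / 4) < (1 + θ)⁻¹ ^ 2 -
      ((((1 + θ) ^ 2) ^ 2 - (1 + θ)⁻¹ ^ 2) / (2 * D₀) + (((1 + θ) ^ 2) ^ 2 - (1 + θ)⁻¹ ^ 2) / (2 * D₀)) ^ 2)
    (hnumB : 4 * (((1 + θ) ^ 2) ^ 2 - D₀ ^ 2 / 4) * ((1 + θ) ^ 2 - D₀ ^ 2 / 4) -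
        ((1 : ℝ) ^ 2 - (((1 + θ) ^ 2 - 1) / (2 * D₀) + (((1 + θ) ^ 2) ^ 2 - (1 + θ)⁻¹ ^ 2) / (2 * D₀)) ^ 2 -
          ((1 + θ) ^ 2 - D₀ ^ 2 / 4) - (((1 + θ) ^ 2) ^ 2 - D₀ ^ 2 / 4)) ^ 2 <
      ((1 + θ)⁻¹ ^ 2 - ((((1 + θ) ^ 2) ^ 2 - (1 + θ)⁻¹ ^ 2) / (2 * D₀) +
        (((1 + θ) ^ 2) ^ 2 - (1 + θ)⁻¹ ^ 2) / (2 * D₀)) ^ 2) * ((1 + θ) ^ 2 - D₀ ^ 2 / 4)) :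
    ThirdNeighbourExclusion θ D₀ := by
  intro A B P₁ P₂ hd hA1 hA2 hB1 hB2 hwA1 hwB1 hwA2 hwB2 hP1 _hP1' hP2 h12
  have hθpos : 0 < 1 + θ := by linarith
  have hR : 0 < ((1 + θ) ^ 2) ^ 2 - D₀ ^ 2 / 4 := by
    have h1 : (1 : ℝ) ≤ (1 + θ) ^ 2 := by
      clear hnumA hnumB hnumC hR₀ hd hwA1 hwB1 hwA2 hwB2 h12
      nlinarith
    have h2 : (1 + θ) ^ 2 ≤ ((1 + θ) ^ 2) ^ 2 := by
      clear hnumA hnumB hnumC hR₀ hd hwA1 hwB1 hwA2 hwB2 h12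
      nlinarith [mul_nonneg (sub_nonneg.2 h1) (sub_nonneg.2 h1)]
    linarith
  have win0 : ∀ Z : E3, 1 ≤ ‖Z‖ → ‖Z‖ ≤ 1 + θ → (1 : ℝ) ≤ dist (0 : E3) Z ^ 2 ∧ dist (0 : E3) Z ^ 2 ≤ (1 + θ) ^ 2 := by
    intro Z h1 h2
    rw [dist_comm, dist_eq_norm, sub_zero]
    exact ⟨one_le_pow₀ h1, pow_le_pow_left₀ (norm_nonneg _) h2 2⟩
  have d01 : (1 : ℝ) ≤ dist (0 : E3) P₁ := by rw [dist_comm, dist_eq_norm, sub_zero]; exact hP1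
  have d02 : (1 : ℝ) ≤ dist (0 : E3) P₂ := by rw [dist_comm, dist_eq_norm, sub_zero]; exact hP2
  exact lens_three_false_centre (A := A) (B := B) (P₀ := 0) (P₁ := P₁) (P₂ := P₂) (D₀ := D₀) (lo₀ := 1)
    (hi₀ := (1 + θ) ^ 2) (lo := (1 + θ)⁻¹ ^ 2) (hi := ((1 + θ) ^ 2) ^ 2) (s₀ := 1) (s := (1 + θ)⁻¹)
    hD₀ hd (win0 A hA1 hA2) (win0 B hB1 hB2) hwA1 hwB1 hwA2 hwB2
    zero_le_one (inv_nonneg.2 hθpos.le) d01 d02 h12 hR₀ hR hnumA hnumC hnumB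

/-! ### §4 Literals -/

/-- `θ = 1/100`, `D₀ = 17/10` (the registered literal of p823696): crude instance. [folklore] -/
theorem thirdNeighbourExclusion_hundredth_17_10 : ThirdNeighbourExclusion (1 / 100) (17 / 10) :=
  thirdNeighbourExclusion_of_lensThree (by norm_num) (by norm_num) (by norm_num)

/-- `θ = 1/100`, `D₀ = 339/200 = 1.695` (critic row 465 fall-back F1): crude instance, exact arithmetic. [folklore] -/
theorem thirdNeighbourExclusion_hundredth_339_200 : ThirdNeighbourExclusion (1 / 100) (339 / 200) :=
  thirdNeighbourExclusion_of_lensThree (by norm_num) (by norm_num) (by norm_num)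

/-- ★ `θ = 1/100`, `D₀ = 42/25 = 1.68`: SHARP instance (the crude condition fails here; the sharp one fails at `167/100`).  Margin to the
census float minimum `1.7146` of the `√3`-pairs over admissible links (TAG 160 (d′)): `3.5θ`. [folklore] -/
theorem thirdNeighbourExclusion_hundredth_42_25 : ThirdNeighbourExclusion (1 / 100) (42 / 25) :=
  thirdNeighbourExclusion_of_centre (by norm_num) (by norm_num) (by norm_num) (by norm_num) (by norm_num) (by norm_num)

/-- `θ = 1/200`, `D₀ = 83/50 = 1.66`: sharp instance for the tolerance literal. [folklore] -/
theorem thirdNeighbourExclusion_twoHundredth_83_50 : ThirdNeighbourExclusion (1 / 200) (83 / 50) :=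
  thirdNeighbourExclusion_of_centre (by norm_num) (by norm_num) (by norm_num) (by norm_num) (by norm_num) (by norm_num)

end Summit.AtomisticToContinuum.Crystallization.Theorems.FrustratedLawDichotomyThirdNeighbour

end
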